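import Mathlib.Analysis.InnerProductSpace.PiL2
import Mathlib.Analysis.CStarAlgebra.Matrix
import Mathlib.LinearAlgebra.Matrix.Kronecker
import Mathlib.LinearAlgebra.UnitaryGroup
import Mathlib.Topology.Instances.Matrix
import HarnessLib

/-!
# Ordered products of matrices, path sums, and a rank-one perturbation bound
# (the combinatorics of Borgs–Seiler's broken Polyakov loops)

Second of three theorem-only support files for the proof of Borgs–Seiler's explicit infrared bound
(`Literature.Barriers.QuantumFields.BorgsSeilerInfraredBoundExplicit`, Commun. Math. Phys. 91
(1983), Lemma III.6). Purely finite-dimensional linear algebra, no measure theory: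

* `cycProd M = M 0 * M 1 * ⋯ * M (n-1)` for `M : Fin n → Matrix ι ι R`, the **path-sum formula**
  for its entries (`cycProd_apply`) and the **closed-path formula** for its trace
  (`trace_cycProd`: `tr ∏ₜ Mₜ = Σ_{γ : Fin n → ι} ∏ₜ Mₜ(γ t, γ (t+1))`, cyclically). The Polyakov
  loop `tr(u₀ u₁ ⋯ u_{L₀-1})` is such a trace; the path sum is how the Gaussian expectation of a
  pair of Polyakov loops factorises over the link variables.
* Kronecker products: `cycProd (B ⊗ A) = cycProd B ⊗ cycProd A`, entrywise conjugation, so that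
  `tr ∏ₜ (pₜ ⊗ q̄ₜ) = f(p) · conj f(q)` with `f = tr ∘ cycProd` — a PAIR of Polyakov loops is one
  loop on `ℂ^N ⊗ ℂ^N`.
* **The rank-one perturbation bound** (`norm_trace_mul_cycProd_sub_le`): for unitary `Aₜ` on a
  finite-dimensional Hilbert space, a vector `ω` and `λ ≥ 0`,
  `|tr(X (∏ₜ (Aₜ + λ|ω⟩⟨ω|) − ∏ₜ Aₜ))| ≤ (1 + λ‖ω‖²)ⁿ − 1` for every unitary `X`.
  With `Aₜ = pₜ ⊗ q̄ₜ`, `ω = Σ_e e ⊗ e` (`‖ω‖² = N`), `λ = 2/J_E`, the expansion of the left side in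
  `λ` is Borgs–Seiler's expansion (III.49)/(III.53) of the double commutator: the term of order
  `λ^k` is the sum over the `(L₀ choose k)` ways of "breaking up the pair of Polyakov loops into
  Wilson loops by replacing `k` pairs of vertical links by pairs of horizontal links" (p. 352,
  Fig. 1), each insertion of `|ω⟩⟨ω|` closing a loop, and the bound is their
  "trivial bound `|W(C)| ≤ χ(1)`" giving `Σₖ (L₀ choose k)(2χ(1)/J_E)^k = (1 + 2χ(1)/J_E)^{L₀} − 1`
  ((III.57)–(III.59)). The proof here is a two-line induction (peel the first factor; the
  rank-one term is a matrix element `⟨ω| ⋯ |ω⟩` bounded by Cauchy–Schwarz) and needs no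
  combinatorics of arcs.
* Entrywise bounds and continuity of `cycProd` (for domination/measurability downstream).

References: C. Borgs, E. Seiler, Commun. Math. Phys. 91 (1983) 329–380, §III.2 (III.49)–(III.59)
(pp. 351–353). [BorgsSeiler1983]
-/

noncomputable section

open Matrix
open scoped ComplexConjugate Matrix Kronecker

namespace Literature.Barriers.QuantumFields.InfraredGaussian

/-! ### Ordered products and path sums -/

section PathSum

variable {ι : Type*} [Fintype ι] [DecidableEq ι] {R : Type*} [CommSemiring R]

/-- The ordered product `cycProd M = M 0 * M 1 * ⋯ * M (n-1)` (a Polyakov loop before taking the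
trace, when `M t` are the time-like link matrices). [folklore] -/
def cycProd {n : ℕ} (M : Fin n → Matrix ι ι R) : Matrix ι ι R := (List.ofFn M).prod

/-- The empty ordered product is `1`. [folklore] -/
@[simp] theorem cycProd_zero (M : Fin 0 → Matrix ι ι R) : cycProd M = 1 := by
  simp [cycProd]

/-- Peeling off the first factor. [folklore] -/
theorem cycProd_succ {n : ℕ} (M : Fin (n + 1) → Matrix ι ι R) :
    cycProd M = M 0 * cycProd (fun t : Fin n => M t.succ) := by
  simp [cycProd, List.ofFn_succ]

omit [DecidableEq ι] in
/-- Summing over paths of length `n + 1` is summing over the first vertex and the remaining path.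
[folklore] -/
theorem sum_paths_cons {n : ℕ} {M' : Type*} [AddCommMonoid M'] (F : (Fin (n + 2) → ι) → M') :
    ∑ q : Fin (n + 2) → ι, F q = ∑ l : ι, ∑ q' : Fin (n + 1) → ι, F (Fin.cons l q') := by
  rw [← (Fin.consEquiv fun _ : Fin (n + 2) => ι).sum_comp, Fintype.sum_prod_type]
  rfl

/-- The weight `∏ₜ Mₜ(q t, q (t+1))` of a path `q` with vertices `q 0, …, q n`. [folklore] -/
def pathWeight {n : ℕ} (M : Fin n → Matrix ι ι R) (q : Fin (n + 1) → ι) : R :=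
  ∏ t : Fin n, M t (q t.castSucc) (q t.succ)

omit [Fintype ι] [DecidableEq ι] in
/-- The weight of a path is the first edge times the weight of the rest. [folklore] -/
theorem pathWeight_cons {n : ℕ} (M : Fin (n + 1) → Matrix ι ι R) (l : ι) (q : Fin (n + 1) → ι) :
    pathWeight M (Fin.cons l q) = M 0 l (q 0) * pathWeight (fun t : Fin n => M t.succ) q := by
  unfold pathWeight
  rw [Fin.prod_univ_succ]
  rfl

/-- **Path-sum formula**: the entries of an ordered product of matrices are sums over paths with
prescribed endpoints, `(∏ₜ Mₜ) i j = Σ_{q : q 0 = i, q n = j} ∏ₜ Mₜ(q t, q (t+1))`. [folklore] -/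
theorem cycProd_apply {n : ℕ} (M : Fin n → Matrix ι ι R) (i j : ι) :
    cycProd M i j =
      ∑ q : Fin (n + 1) → ι, if q 0 = i ∧ q (Fin.last n) = j then pathWeight M q else 0 := by
  induction n generalizing i with
  | zero =>
      rw [cycProd_zero, Matrix.one_apply]
      rw [Fintype.sum_equiv (Equiv.funUnique (Fin 1) ι) _
        (fun x : ι => if x = i ∧ x = j then (1 : R) else 0) (fun q => by
          simp [Equiv.funUnique, Fin.last, pathWeight])]
      by_cases h : i = j
      · subst h; simp
      · rw [if_neg h]
        rw [Finset.sum_eq_zero]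
        rintro x -
        rw [if_neg]
        rintro ⟨rfl, rfl⟩
        exact h rfl
  | succ n ih =>
      rw [cycProd_succ, Matrix.mul_apply]
      simp_rw [ih]
      have hmid : ∀ q : Fin (n + 1) → ι,
          (∑ l : ι, if q 0 = l ∧ q (Fin.last n) = j
              then M 0 i l * pathWeight (fun t : Fin n => M t.succ) q else 0) =
            if q (Fin.last n) = j then M 0 i (q 0) * pathWeight (fun t : Fin n => M t.succ) q
              else 0 := by
        intro q
        by_cases hq : q (Fin.last n) = j
        · simp only [hq, and_true, if_true]
          rw [Finset.sum_eq_single (q 0) (fun b _ hb => if_neg (Ne.symm hb))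
            (fun h => absurd (Finset.mem_univ _) h), if_pos rfl]
        · simp [hq]
      calc (∑ l, M 0 i l * ∑ q : Fin (n + 1) → ι,
              if q 0 = l ∧ q (Fin.last n) = j then pathWeight (fun t : Fin n => M t.succ) q else 0)
          = ∑ l, ∑ q : Fin (n + 1) → ι, (if q 0 = l ∧ q (Fin.last n) = j
              then M 0 i l * pathWeight (fun t : Fin n => M t.succ) q else 0) := by
            refine Finset.sum_congr rfl fun l _ => ?_
            rw [Finset.mul_sum]
            refine Finset.sum_congr rfl fun q _ => ?_
            split_ifs <;> simp
        _ = ∑ q : Fin (n + 1) → ι, (if q (Fin.last n) = j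
              then M 0 i (q 0) * pathWeight (fun t : Fin n => M t.succ) q else 0) := by
            rw [Finset.sum_comm]
            exact Finset.sum_congr rfl fun q _ => hmid q
        _ = ∑ l, ∑ q : Fin (n + 1) → ι, (if (Fin.cons l q : Fin (n + 2) → ι) 0 = i ∧
              (Fin.cons l q : Fin (n + 2) → ι) (Fin.last (n + 1)) = j
              then pathWeight M (Fin.cons l q) else 0) := by
            simp only [Fin.cons_zero]
            have hlast : ∀ (l : ι) (q : Fin (n + 1) → ι),
                (Fin.cons l q : Fin (n + 2) → ι) (Fin.last (n + 1)) = q (Fin.last n) := by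
              intro l q
              rw [← Fin.succ_last, Fin.cons_succ]
            simp_rw [hlast, pathWeight_cons]
            rw [Finset.sum_comm]
            refine Finset.sum_congr rfl fun q _ => ?_
            by_cases hq : q (Fin.last n) = j
            · simp only [hq, and_true, if_true]
              rw [Finset.sum_ite_eq' Finset.univ i, if_pos (Finset.mem_univ _)]
            · simp only [hq, and_false, if_false, Finset.sum_const_zero]
        _ = _ := (sum_paths_cons (fun q : Fin (n + 2) → ι =>
            if q 0 = i ∧ q (Fin.last (n + 1)) = j then pathWeight M q else 0)).symm

/-- **Closed paths**: the trace of an ordered product of `n ≥ 1` matrices is the sum over cyclic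
index assignments, `tr ∏ₜ Mₜ = Σ_{γ : Fin n → ι} ∏ₜ Mₜ(γ t, γ (t+1))` (addition in `Fin n`, i.e.
cyclically). [folklore] -/
theorem trace_cycProd {n : ℕ} [NeZero n] (M : Fin n → Matrix ι ι R) :
    (cycProd M).trace = ∑ γ : Fin n → ι, ∏ t : Fin n, M t (γ t) (γ (t + 1)) := by
  obtain ⟨m, rfl⟩ := Nat.exists_eq_succ_of_ne_zero (NeZero.ne n)
  have hsucc : ∀ (γ : Fin (m + 1) → ι) (t : Fin (m + 1)),
      (Fin.snoc γ (γ 0) : Fin (m + 2) → ι) t.succ = γ (t + 1) := by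
    intro γ t
    by_cases ht : t = Fin.last m
    · subst ht
      rw [Fin.succ_last, Fin.snoc_last, Fin.last_add_one]
    · obtain ⟨t', rfl⟩ := Fin.exists_castSucc_eq.2 ht
      rw [Fin.coeSucc_eq_succ, Fin.succ_castSucc]
      exact Fin.snoc_castSucc (α := fun _ => ι) _ _ _
  calc (cycProd M).trace
      = ∑ i, ∑ q : Fin (m + 2) → ι,
          if q 0 = i ∧ q (Fin.last (m + 1)) = i then pathWeight M q else 0 := by
        simp only [Matrix.trace, Matrix.diag_apply, cycProd_apply]
    _ = ∑ q : Fin (m + 2) → ι, if q 0 = q (Fin.last (m + 1)) then pathWeight M q else 0 := by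
        rw [Finset.sum_comm]
        refine Finset.sum_congr rfl fun q _ => ?_
        by_cases hq : q 0 = q (Fin.last (m + 1))
        · rw [if_pos hq, Finset.sum_eq_single (q 0) (fun b _ hb => if_neg fun h => hb h.1.symm)
            (fun h => absurd (Finset.mem_univ _) h), if_pos ⟨rfl, hq.symm⟩]
        · rw [if_neg hq]
          refine Finset.sum_eq_zero fun i _ => if_neg ?_
          rintro ⟨h1, h2⟩
          exact hq (h1.trans h2.symm)
    _ = ∑ x : ι, ∑ γ : Fin (m + 1) → ι, if (Fin.snoc γ x : Fin (m + 2) → ι) 0 =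
          (Fin.snoc γ x : Fin (m + 2) → ι) (Fin.last (m + 1)) then pathWeight M (Fin.snoc γ x)
          else 0 := by
        rw [← (Fin.snocEquiv fun _ : Fin (m + 2) => ι).sum_comp, Fintype.sum_prod_type]
        rfl
    _ = ∑ γ : Fin (m + 1) → ι, pathWeight M (Fin.snoc γ (γ 0)) := by
        rw [Finset.sum_comm]
        refine Finset.sum_congr rfl fun γ _ => ?_
        have h0 : ∀ x : ι, (Fin.snoc γ x : Fin (m + 2) → ι) 0 = γ 0 := fun x =>
          Fin.snoc_castSucc (α := fun _ => ι) x γ 0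
        simp only [h0, Fin.snoc_last]
        rw [Finset.sum_ite_eq Finset.univ (γ 0), if_pos (Finset.mem_univ _)]
    _ = ∑ γ : Fin (m + 1) → ι, ∏ t, M t (γ t) (γ (t + 1)) := by
        refine Finset.sum_congr rfl fun γ _ => ?_
        unfold pathWeight
        refine Finset.prod_congr rfl fun t _ => ?_
        rw [hsucc, Fin.snoc_castSucc]

end PathSum

/-! ### Vectors, unitaries and the rank-one perturbation bound -/

section RankOne

variable {V : Type*} [Fintype V]

/-- Euclidean norm of a vector `V → ℂ` (via `EuclideanSpace`). [folklore] -/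
def vnorm (φ : V → ℂ) : ℝ := ‖(WithLp.toLp 2 φ : EuclideanSpace ℂ V)‖

/-- `‖φ‖ ≥ 0`. [folklore] -/
theorem vnorm_nonneg (φ : V → ℂ) : 0 ≤ vnorm φ := norm_nonneg _

/-- Cauchy–Schwarz: `|φ† ψ| ≤ ‖φ‖ ‖ψ‖`. [folklore] -/
theorem norm_star_dotProduct_le (φ ψ : V → ℂ) : ‖star φ ⬝ᵥ ψ‖ ≤ vnorm φ * vnorm ψ := by
  have h := norm_inner_le_norm (𝕜 := ℂ) (WithLp.toLp 2 φ : EuclideanSpace ℂ V) (WithLp.toLp 2 ψ)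
  rw [EuclideanSpace.inner_eq_star_dotProduct] at h
  simpa [vnorm, dotProduct_comm] using h

/-- `‖φ‖² = Re (φ† φ)`. [folklore] -/
theorem vnorm_sq (φ : V → ℂ) : vnorm φ ^ 2 = (star φ ⬝ᵥ φ).re := by
  have h := inner_self_eq_norm_sq (𝕜 := ℂ) (WithLp.toLp 2 φ : EuclideanSpace ℂ V)
  rw [EuclideanSpace.inner_eq_star_dotProduct] at h
  simp only [vnorm]
  rw [← h]
  simp [dotProduct_comm]

/-- Moving a matrix across the pairing: `φ† (M ψ) = (Mᴴ φ)† ψ`. [folklore] -/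
theorem star_dotProduct_mulVec (φ ψ : V → ℂ) (M : Matrix V V ℂ) :
    star φ ⬝ᵥ (M *ᵥ ψ) = star (Mᴴ *ᵥ φ) ⬝ᵥ ψ := by
  rw [star_mulVec, conjTranspose_conjTranspose, dotProduct_mulVec]

/-- The rank-one matrix `|ω⟩⟨ω|` acts by `v ↦ (ω† v) ω`. [folklore] -/
theorem vecMulVec_star_mulVec (ω v : V → ℂ) :
    vecMulVec ω (star ω) *ᵥ v = (star ω ⬝ᵥ v) • ω := by
  ext i
  simp [vecMulVec, mulVec, dotProduct, Finset.mul_sum, mul_comm, mul_left_comm]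

/-- `tr(|ω⟩⟨ω| M) = ω† M ω`. [folklore] -/
theorem trace_vecMulVec_star_mul (ω : V → ℂ) (M : Matrix V V ℂ) :
    (vecMulVec ω (star ω) * M).trace = star ω ⬝ᵥ (M *ᵥ ω) := by
  rw [trace_mul_comm, mul_vecMulVec, trace_vecMulVec, dotProduct_comm]

variable [DecidableEq V]

/-- Unitary matrices preserve the norm. [folklore] -/
theorem vnorm_mulVec_of_mem_unitaryGroup {U : Matrix V V ℂ} (hU : U ∈ Matrix.unitaryGroup V ℂ)
    (ψ : V → ℂ) : vnorm (U *ᵥ ψ) = vnorm ψ := by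
  have h1 : star (U *ᵥ ψ) ⬝ᵥ (U *ᵥ ψ) = star ψ ⬝ᵥ ψ := by
    rw [star_mulVec, ← dotProduct_mulVec, mulVec_mulVec]
    have : Uᴴ * U = 1 := by
      have := Matrix.mem_unitaryGroup_iff'.1 hU
      simpa [Matrix.star_eq_conjTranspose] using this
    rw [this, one_mulVec]
  have h2 : vnorm (U *ᵥ ψ) ^ 2 = vnorm ψ ^ 2 := by rw [vnorm_sq, vnorm_sq, h1]
  exact (pow_left_inj₀ (vnorm_nonneg _) (vnorm_nonneg _) two_ne_zero).1 h2

variable {n : ℕ}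

/-- **Matrix elements of the perturbed product**: for unitary `A t`, a vector `ω` and `lam ≥ 0`,
`|φ† (∏ₜ (A t + lam |ω⟩⟨ω|)) ψ| ≤ ‖φ‖ ‖ψ‖ (1 + lam ‖ω‖²)ⁿ` (induction on `n`: peel the first
factor; the rank-one term is `lam (ω†⋯ψ)(φ†ω)`, both factors bounded by Cauchy–Schwarz). [folklore] -/
theorem norm_star_dotProduct_cycProd_mulVec_le (A : Fin n → Matrix V V ℂ)
    (hA : ∀ t, A t ∈ Matrix.unitaryGroup V ℂ) (ω : V → ℂ) {lam : ℝ} (hlam : 0 ≤ lam) (φ ψ : V → ℂ) :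
    ‖star φ ⬝ᵥ (cycProd (fun t => A t + (lam : ℂ) • vecMulVec ω (star ω)) *ᵥ ψ)‖ ≤
      vnorm φ * vnorm ψ * (1 + lam * vnorm ω ^ 2) ^ n := by
  induction n generalizing φ ψ with
  | zero =>
      simp only [cycProd_zero, one_mulVec, pow_zero, mul_one]
      exact norm_star_dotProduct_le φ ψ
  | succ n ih =>
      rw [cycProd_succ, ← mulVec_mulVec, add_mulVec, smul_mulVec, dotProduct_add,
        dotProduct_smul, vecMulVec_star_mulVec, dotProduct_smul, star_dotProduct_mulVec φ]
      set v := cycProd (fun t : Fin n => A t.succ + (lam : ℂ) • vecMulVec ω (star ω)) *ᵥ ψ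
      have hA0 : (A 0)ᴴ ∈ Matrix.unitaryGroup V ℂ := by
        have := Unitary.star_mem (hA 0)
        simpa [Matrix.star_eq_conjTranspose] using this
      have h1 := ih (fun t => A t.succ) (fun t => hA t.succ) ((A 0)ᴴ *ᵥ φ) ψ
      rw [vnorm_mulVec_of_mem_unitaryGroup hA0] at h1
      have h2 := ih (fun t => A t.succ) (fun t => hA t.succ) ω ψ
      have h3 := norm_star_dotProduct_le φ ω
      have hpos : 0 ≤ (1 + lam * vnorm ω ^ 2) ^ n := pow_nonneg (by positivity) n
      calc ‖star ((A 0)ᴴ *ᵥ φ) ⬝ᵥ v + (lam : ℂ) • ((star ω ⬝ᵥ v) • (star φ ⬝ᵥ ω))‖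
          ≤ ‖star ((A 0)ᴴ *ᵥ φ) ⬝ᵥ v‖ + ‖(lam : ℂ) • ((star ω ⬝ᵥ v) • (star φ ⬝ᵥ ω))‖ :=
            norm_add_le _ _
        _ ≤ vnorm φ * vnorm ψ * (1 + lam * vnorm ω ^ 2) ^ n +
            lam * ((vnorm ω * vnorm ψ * (1 + lam * vnorm ω ^ 2) ^ n) * (vnorm φ * vnorm ω)) := by
            refine add_le_add h1 ?_
            simp only [Complex.norm_real, Real.norm_of_nonneg hlam, smul_eq_mul, norm_mul]
            exact mul_le_mul_of_nonneg_left (mul_le_mul h2 h3 (norm_nonneg _)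
              (mul_nonneg (mul_nonneg (vnorm_nonneg _) (vnorm_nonneg _)) hpos)) hlam
        _ = vnorm φ * vnorm ψ * (1 + lam * vnorm ω ^ 2) ^ (n + 1) := by ring

/-- **The rank-one perturbation bound**: for unitary `A t`, unitary `X`, a vector `ω` and
`lam ≥ 0`, `|tr(X (∏ₜ (A t + lam |ω⟩⟨ω|) − ∏ₜ A t))| ≤ (1 + lam ‖ω‖²)ⁿ − 1`. The expansion of the
left side in `lam` is Borgs–Seiler's broken-loop expansion (III.49)/(III.53)/(III.56) and the bound is
their `Σₖ (L₀ choose k)(2χ(1)/J_E)^k = (1 + 2χ(1)/J_E)^{L₀} − 1` from `|W(C)| ≤ χ(1)` ((III.57)–(III.59)),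
here obtained by peeling factors: `∏ₜ (Aₜ + λP) − ∏ₜ Aₜ = A₀(⋯) + λ P ∏_{t>0}(Aₜ + λP)` and
`tr(X P Y) = ω† (Y X) ω`. [cite: BorgsSeiler1983, §III.2 (III.49)–(III.59) (pp. 351–353)] -/
theorem norm_trace_mul_cycProd_sub_le (A : Fin n → Matrix V V ℂ)
    (hA : ∀ t, A t ∈ Matrix.unitaryGroup V ℂ) (ω : V → ℂ) {lam : ℝ} (hlam : 0 ≤ lam)
    {X : Matrix V V ℂ} (hX : X ∈ Matrix.unitaryGroup V ℂ) :
    ‖(X * (cycProd (fun t => A t + (lam : ℂ) • vecMulVec ω (star ω)) - cycProd A)).trace‖ ≤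
      (1 + lam * vnorm ω ^ 2) ^ n - 1 := by
  induction n generalizing X with
  | zero => simp
  | succ n ih =>
      have hsplit : cycProd (fun t => A t + (lam : ℂ) • vecMulVec ω (star ω)) - cycProd A =
          A 0 * (cycProd (fun t : Fin n => A t.succ + (lam : ℂ) • vecMulVec ω (star ω)) -
            cycProd (fun t : Fin n => A t.succ)) +
          (lam : ℂ) • (vecMulVec ω (star ω) *
            cycProd (fun t : Fin n => A t.succ + (lam : ℂ) • vecMulVec ω (star ω))) := by
        rw [cycProd_succ, cycProd_succ]
        simp only [add_mul, smul_mul_assoc, mul_sub]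
        abel
      rw [hsplit, mul_add, trace_add, ← mul_assoc, mul_smul_comm, trace_smul]
      have hXA : X * A 0 ∈ Matrix.unitaryGroup V ℂ := Submonoid.mul_mem _ hX (hA 0)
      have h1 := ih (fun t => A t.succ) (fun t => hA t.succ) hXA
      have h2 : ‖(X * (vecMulVec ω (star ω) *
          cycProd (fun t : Fin n => A t.succ + (lam : ℂ) • vecMulVec ω (star ω)))).trace‖ ≤
          vnorm ω ^ 2 * (1 + lam * vnorm ω ^ 2) ^ n := by
        rw [← mul_assoc, trace_mul_cycle, trace_mul_comm, trace_vecMulVec_star_mul, ← mulVec_mulVec]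
        have h := norm_star_dotProduct_cycProd_mulVec_le (fun t => A t.succ) (fun t => hA t.succ)
          ω hlam ω (X *ᵥ ω)
        rw [vnorm_mulVec_of_mem_unitaryGroup hX] at h
        simpa [sq, mul_assoc] using h
      calc _ ≤ ‖(X * A 0 * (cycProd (fun t : Fin n => A t.succ + (lam : ℂ) • vecMulVec ω (star ω)) -
              cycProd (fun t : Fin n => A t.succ))).trace‖ +
            ‖(lam : ℂ) • (X * (vecMulVec ω (star ω) *
              cycProd (fun t : Fin n => A t.succ + (lam : ℂ) • vecMulVec ω (star ω)))).trace‖ :=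
            norm_add_le _ _
        _ ≤ ((1 + lam * vnorm ω ^ 2) ^ n - 1) + lam * (vnorm ω ^ 2 * (1 + lam * vnorm ω ^ 2) ^ n) := by
            refine add_le_add h1 ?_
            rw [norm_smul, Complex.norm_real, Real.norm_of_nonneg hlam]
            exact mul_le_mul_of_nonneg_left h2 hlam
        _ = (1 + lam * vnorm ω ^ 2) ^ (n + 1) - 1 := by ring

end RankOne

/-! ### Kronecker products, conjugation, the vector `ω` and the matrix `P = |ω⟩⟨ω|` -/

section KroneckerConj

variable {N : ℕ}

/-- Ordered products commute with Kronecker products. [folklore] -/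
theorem cycProd_kronecker {n : ℕ} (B A : Fin n → Matrix (Fin N) (Fin N) ℂ) :
    cycProd (fun t => B t ⊗ₖ A t) = cycProd B ⊗ₖ cycProd A := by
  induction n with
  | zero => simp [cycProd_zero]
  | succ n ih =>
      rw [cycProd_succ, cycProd_succ, cycProd_succ, ih, ← Matrix.mul_kronecker_mul]

/-- Ordered products commute with entrywise conjugation. [folklore] -/
theorem cycProd_map_conj {n : ℕ} (q : Fin n → Matrix (Fin N) (Fin N) ℂ) :
    cycProd (fun t => (q t).map conj) = (cycProd q).map conj := by
  induction n with
  | zero => simp [cycProd_zero]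
  | succ n ih =>
      rw [cycProd_succ, cycProd_succ, ih, ← Matrix.map_mul]

/-- `tr (M.map conj) = conj (tr M)`. [folklore] -/
theorem trace_map_conj {ι : Type*} [Fintype ι] (M : Matrix ι ι ℂ) :
    (M.map conj).trace = conj M.trace := by
  simp [Matrix.trace, map_sum]

/-- Entrywise conjugates of unitaries are unitary. [folklore] -/
theorem map_conj_mem_unitaryGroup {q : Matrix (Fin N) (Fin N) ℂ}
    (hq : q ∈ Matrix.unitaryGroup (Fin N) ℂ) : q.map conj ∈ Matrix.unitaryGroup (Fin N) ℂ := by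
  rw [Matrix.mem_unitaryGroup_iff] at hq ⊢
  rw [Matrix.star_eq_conjTranspose, ← Matrix.conjTranspose_map conj (fun z => rfl),
    ← Matrix.map_mul, ← Matrix.star_eq_conjTranspose, hq, Matrix.map_one conj (map_zero _) (map_one _)]

/-- The vector `ω = Σ_e e ⊗ e` on `ℂ^N ⊗ ℂ^N` (coordinates `ω (e, e') = [e = e']`). [folklore] -/
def omegaVec (N : ℕ) : Fin N × Fin N → ℂ := fun p => if p.1 = p.2 then 1 else 0

/-- The rank-one matrix `P = |ω⟩⟨ω|` (entries `P (c,c') (e,e') = [c = c'][e = e']`): its insertion in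
place of a factor `pₜ ⊗ q̄ₜ` of the doubled loop contracts the indices of the two loops at layer `t`,
"replacing a pair of vertical links by a pair of horizontal links" (Borgs–Seiler p. 352). [cite: BorgsSeiler1983, §III.2 (III.50)–(III.56) (pp. 351–352)] -/
def Pmat (N : ℕ) : Matrix (Fin N × Fin N) (Fin N × Fin N) ℂ := vecMulVec (omegaVec N) (star (omegaVec N))

/-- Entries of `P`. [folklore] -/
theorem Pmat_apply (p q : Fin N × Fin N) :
    Pmat N p q = if p.1 = p.2 ∧ q.1 = q.2 then 1 else 0 := by
  simp only [Pmat, vecMulVec_apply, omegaVec, Pi.star_apply]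
  split_ifs <;> simp_all

/-- `‖ω‖² = N` (`= χ(1)`, the trace of the identity: the value of a degenerate Wilson loop). [folklore] -/
theorem vnorm_omegaVec_sq (N : ℕ) : vnorm (omegaVec N) ^ 2 = N := by
  rw [vnorm_sq]
  simp only [dotProduct, Pi.star_apply, omegaVec]
  have : ∀ p : Fin N × Fin N, (star (if p.1 = p.2 then (1 : ℂ) else 0)) * (if p.1 = p.2 then 1 else 0) =
      if p.1 = p.2 then 1 else 0 := fun p => by split_ifs <;> simp
  simp_rw [this]
  rw [Fintype.sum_prod_type]
  simp

/-- Entrywise bound for ordered products: if all entries of all `M t` are bounded by `m`, the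
entries of `∏ₜ Mₜ` are bounded by `(N m)ⁿ`. [folklore] -/
theorem norm_cycProd_apply_le {n : ℕ} {M : Fin n → Matrix (Fin N) (Fin N) ℂ} {m : ℝ} (hm : 0 ≤ m)
    (hM : ∀ t e e', ‖M t e e'‖ ≤ m) (e e' : Fin N) : ‖cycProd M e e'‖ ≤ (N * m) ^ n := by
  induction n generalizing e with
  | zero =>
      rw [cycProd_zero, pow_zero, Matrix.one_apply]
      split_ifs <;> simp
  | succ n ih =>
      rw [cycProd_succ, Matrix.mul_apply]
      calc ‖∑ l, M 0 e l * cycProd (fun t : Fin n => M t.succ) l e'‖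
          ≤ ∑ l, ‖M 0 e l * cycProd (fun t : Fin n => M t.succ) l e'‖ := norm_sum_le _ _
        _ ≤ ∑ _l : Fin N, m * (N * m) ^ n := Finset.sum_le_sum fun l _ => by
            rw [norm_mul]
            exact mul_le_mul (hM 0 e l) (ih (fun t => hM t.succ) l) (norm_nonneg _) hm
        _ = (N * m) ^ (n + 1) := by
            rw [Finset.sum_const, Finset.card_univ, Fintype.card_fin, nsmul_eq_mul]; ring

/-- The ordered product is continuous in its factors. [folklore] -/
@[fun_prop] theorem continuous_cycProd {n : ℕ} :
    Continuous (cycProd : (Fin n → Matrix (Fin N) (Fin N) ℂ) → _) := by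
  induction n with
  | zero =>
      have : (cycProd : (Fin 0 → Matrix (Fin N) (Fin N) ℂ) → _) = fun _ => 1 := funext cycProd_zero
      rw [this]; exact continuous_const
  | succ n ih =>
      have : (cycProd : (Fin (n + 1) → Matrix (Fin N) (Fin N) ℂ) → _) =
          fun M => M 0 * cycProd (fun t : Fin n => M t.succ) := funext cycProd_succ
      rw [this]
      exact (continuous_apply 0).mul (ih.comp (continuous_pi fun t => continuous_apply _))

end KroneckerConj

end Literature.Barriers.QuantumFields.InfraredGaussian

end
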